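import Mathlib
import HarnessLib

/-!
# Mellin-type parametric integrals with compactly supported kernels are entire

Analytic kernel of the line `Sketch` (card `compact-kirillov-local-division`) of the route input
`PairLBoundaryJS` (item stmt-Langlands-13622): local Rankin–Selberg zeta integrals whose kernel is
compactly supported are entire functions of `s`.  Abstractly: for a Borel space `X` with a measure
finite on compact sets, a continuous compactly supported `f : X → ℂ` and a continuous positive
weight `w : X → ℝ`, the parametric integral `s ↦ ∫ f x * (w x) ^ s ∂μ` is differentiable on all of
`ℂ` (`mellin_entire_of_hasCompactSupport`).

The proof differentiates under the integral sign
(`hasDerivAt_integral_of_dominated_loc_of_deriv_le`) on the ball of radius `1` around each `s₀`,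
dominating the `s`-derivative `f x * ((w x) ^ s * log (w x))` by the continuous compactly
supported function `‖f x‖ * (((w x) ^ (re s₀ + 1) + (w x) ^ (re s₀ - 1)) * |log (w x)|)`.
-/

noncomputable section

-- `Summit.Langlands.Langlands.…` (summit = sub-problem name, D-0017 layout) trips `dupNamespace`
set_option linter.dupNamespace false

open MeasureTheory Complex

namespace Summit.Langlands.Langlands.Theorems

/-- For `0 < t` and real exponents `r`, `r₀` with `|r - r₀| ≤ 1`, the power `t ^ r` is at most
`t ^ (r₀ + 1) + t ^ (r₀ - 1)`: the first summand dominates when `1 ≤ t`, the second when `t ≤ 1`. -/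
private lemma rpow_le_rpow_add_rpow_of_abs_sub_le {t r r₀ : ℝ} (ht : 0 < t) (h : |r - r₀| ≤ 1) :
    t ^ r ≤ t ^ (r₀ + 1) + t ^ (r₀ - 1) := by
  obtain ⟨h₁, h₂⟩ := abs_sub_le_iff.1 h
  rcases le_or_gt 1 t with h1t | ht1
  · exact le_add_of_le_of_nonneg (Real.rpow_le_rpow_of_exponent_le h1t (by linarith))
      (Real.rpow_nonneg ht.le _)
  · exact le_add_of_nonneg_of_le (Real.rpow_nonneg ht.le _)
      (Real.rpow_le_rpow_of_exponent_ge ht ht1.le (by linarith))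

/-- **Mellin-type parametric integrals with compactly supported continuous kernels are entire.**
Let `X` be a locally compact Borel space with a measure `μ` finite on compact sets, `f : X → ℂ`
continuous with compact support and `w : X → ℝ` continuous and everywhere positive.  Then
`s ↦ ∫ x, f x * (w x : ℂ) ^ s ∂μ` is differentiable on the whole complex plane.  (Here
`(w x : ℂ) ^ s = exp (s * log (w x))` is the principal complex power of the positive real `w x`.)
The derivative at `s` is `∫ x, f x * ((w x : ℂ) ^ s * log (w x)) ∂μ`, obtained by differentiating
under the integral sign with the domination
`‖f x * ((w x) ^ s * log (w x))‖ ≤ ‖f x‖ * (((w x) ^ (re s₀ + 1) + (w x) ^ (re s₀ - 1)) * |log (w x)|)`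
for `s` in the unit ball around `s₀`. -/
theorem mellin_entire_of_hasCompactSupport {X : Type*} [TopologicalSpace X] [MeasurableSpace X]
    [BorelSpace X] [LocallyCompactSpace X] (μ : Measure X) [IsFiniteMeasureOnCompacts μ]
    {f : X → ℂ} (hf : Continuous f) (hsupp : HasCompactSupport f)
    {w : X → ℝ} (hw : Continuous w) (hpos : ∀ x, 0 < w x) :
    Differentiable ℂ fun s : ℂ => ∫ x, f x * ((w x : ℂ) ^ s) ∂μ := by
  intro s₀
  -- the complexified weight, its complex powers and its logarithm are continuous in `x`
  have hwc : Continuous fun x => (w x : ℂ) := continuous_ofReal.comp hw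
  have hslit : ∀ x, (w x : ℂ) ∈ slitPlane := fun x => ofReal_mem_slitPlane.2 (hpos x)
  have hcpow : ∀ s : ℂ, Continuous fun x => (w x : ℂ) ^ s := fun s =>
    hwc.cpow continuous_const hslit
  have hclog : Continuous fun x => log (w x : ℂ) := hwc.clog hslit
  -- the hypotheses of `hasDerivAt_integral_of_dominated_loc_of_deriv_le` on `ball s₀ 1`
  have h1 : ∀ᶠ s in nhds s₀, AEStronglyMeasurable (fun x => f x * (w x : ℂ) ^ s) μ :=
    Filter.Eventually.of_forall fun s => (hf.mul (hcpow s)).aestronglyMeasurable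
  have h2 : Integrable (fun x => f x * (w x : ℂ) ^ s₀) μ :=
    (hf.mul (hcpow s₀)).integrable_of_hasCompactSupport hsupp.mul_right
  have h3 : AEStronglyMeasurable (fun x => f x * ((w x : ℂ) ^ s₀ * log (w x : ℂ))) μ :=
    (hf.mul ((hcpow s₀).mul hclog)).aestronglyMeasurable
  have h4 : ∀ᵐ x ∂μ, ∀ s ∈ Metric.ball s₀ 1, ‖f x * ((w x : ℂ) ^ s * log (w x : ℂ))‖ ≤
      ‖f x‖ * ((w x ^ (s₀.re + 1) + w x ^ (s₀.re - 1)) * |Real.log (w x)|) := by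
    refine Filter.Eventually.of_forall fun x s hs => ?_
    rw [norm_mul, norm_mul, norm_cpow_eq_rpow_re_of_pos (hpos x), ← ofReal_log (hpos x).le,
      norm_real, Real.norm_eq_abs]
    gcongr
    refine rpow_le_rpow_add_rpow_of_abs_sub_le (hpos x) ?_
    rw [← sub_re]
    exact (abs_re_le_norm _).trans (mem_ball_iff_norm.1 hs).le
  have h5 : Integrable
      (fun x => ‖f x‖ * ((w x ^ (s₀.re + 1) + w x ^ (s₀.re - 1)) * |Real.log (w x)|)) μ := by
    refine Continuous.integrable_of_hasCompactSupport ?_ hsupp.norm.mul_right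
    have hw₀ : ∀ x, w x ≠ 0 := fun x => (hpos x).ne'
    have hc₁ : Continuous fun x => w x ^ (s₀.re + 1) := hw.rpow_const fun x => Or.inl (hw₀ x)
    have hc₂ : Continuous fun x => w x ^ (s₀.re - 1) := hw.rpow_const fun x => Or.inl (hw₀ x)
    have hc₃ : Continuous fun x => Real.log (w x) := hw.log hw₀
    exact hf.norm.mul ((hc₁.add hc₂).mul (continuous_abs.comp hc₃))
  have h6 : ∀ᵐ x ∂μ, ∀ s ∈ Metric.ball s₀ 1,
      HasDerivAt (fun s : ℂ => f x * (w x : ℂ) ^ s) (f x * ((w x : ℂ) ^ s * log (w x : ℂ))) s :=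
    Filter.Eventually.of_forall fun x s _ =>
      ((hasStrictDerivAt_const_cpow (Or.inl (ofReal_ne_zero.2 (hpos x).ne'))).hasDerivAt).const_mul
        (f x)
  exact (hasDerivAt_integral_of_dominated_loc_of_deriv_le (Metric.ball_mem_nhds s₀ one_pos)
    h1 h2 h3 h4 h5 h6).2.differentiableAt

end Summit.Langlands.Langlands.Theorems

end
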